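import Summits.CriticalPhenomena.Ising3DConformalLimit.Theorems.EnergyNotSigmaSquaredGapForcesFarMergingSandwichDefs
import Summits.CriticalPhenomena.Ising3DConformalLimit.Theorems.EnergyNotSigmaSquaredGapForcesFarMergingSandwichNearPinchFloorAux
import HarnessLib

/-! # The near-pinch floor of the one-pinch duplicated system
(line `one-cluster-depletion-sandwich` of crux `GapForcesFarMerging`, item stmt-CriticalPhenomena-4468;
helper file of stub `stub_octaveCounting`, registered helper `nearPinchFloor`)

For every radius `R` there is `δ₀(R) > 0` such that for every far octave `K` with `2^K > R`, eventually
in the box size `n`, the two INDEPENDENT duplicated clusters `C_{n₁+n₂}(0)` (sources `0, p_K`) and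
`C_{n₃+n₄}(e₂)` (sources `e₂, q_K`) of the one-pinch system avoid each other inside the ball `Λ_R`
with probability `≥ δ₀`: `avoidIn n R (pinch K) ≥ δ₀`, uniformly in the far ends.

Proof (finite-energy surgery, one current at a time, then independence). Let
`T₁ = {(0,0,t) : t ≥ 0}`, `T₂ = {(0,1,-t) : t ≥ 0}` (disjoint escape corridors of `0` and `e₂`) and
`S_i = Λ_R ∖ T_i`. If the trace `n₁+n₂` has no open pair at any site of `S₁`, then
`C_{n₁+n₂}(0) ∩ Λ_R ⊆ T₁`; likewise `C_{n₃+n₄}(e₂) ∩ Λ_R ⊆ T₂` when `n₃+n₄` vanishes at `S₂`; so the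
product of the two events forces avoidance inside `Λ_R` (`prod_subset_compl_meetIn`), and each has
probability bounded below uniformly in `n` and in the far end by the one-current floor `traceLaw_hole_ge`
of the sibling file `…SandwichNearPinchFloorAux` (escape segments `{(0,0,t)}`, `{(0,1,-t)}`, `0 ≤ t ≤ R+1`,
positivity along them by `isingCorr_axisMove_pos`); independence of the two pairs of currents
(`fourTraceLaw` is a product law) multiplies the two floors.
References: Aizenman–Duminil-Copin 2021, §3.1–3.2; Aizenman–Duminil-Copin–Sidoravicius 2015, (2.13)–(2.14);
Friedli–Velenik 2017, Exercise 3.31. -/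

noncomputable section

namespace Summit.CriticalPhenomena.Ising3DConformalLimit.EnergyNotSigmaSquaredGapForcesFarMergingSandwich

namespace NearPinchFloorProof

open scoped symmDiff ENNReal
open MeasureTheory Filter
open Literature.Probability.LatticeModels Literature.Probability.Percolation
open Summit.CriticalPhenomena.Ising3DConformalLimit.GapForcesFarMergingSandwich
open Summit.CriticalPhenomena.Ising3DConformalLimit.EnergyNotSigmaSquaredGapForcesFarMerging

/-! ### Geometry of the one-pinch system near the pinch -/

/-- Coordinates of `p_K = (2^K, 0, 2^K)`. [folklore] -/
theorem pFar_coords (K : ℕ) : pFar K 0 = 2 ^ K ∧ pFar K 1 = 0 ∧ pFar K 2 = 2 ^ K := by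
  refine ⟨?_, ?_, ?_⟩ <;> simp [pFar]

/-- Coordinates of `q_K = (2^K, 0, -2^K)`. [folklore] -/
theorem qFar_coords (K : ℕ) : qFar K 0 = 2 ^ K ∧ qFar K 1 = 0 ∧ qFar K 2 = -2 ^ K := by
  refine ⟨?_, ?_, ?_⟩ <;> simp [qFar]

/-- Coordinates of `e₂ = (0,1,0)`. [folklore] -/
theorem e₂_coords' : (e₂ : Site 3) 0 = 0 ∧ (e₂ : Site 3) 1 = 1 ∧ (e₂ : Site 3) 2 = 0 := by
  refine ⟨?_, ?_, ?_⟩ <;> simp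

/-- Coordinates of the points `(0,0,t)`. [folklore] -/
theorem zAxisPt_coords (t : ℤ) :
    Function.update (0 : Site 3) 2 t 0 = 0 ∧ Function.update (0 : Site 3) 2 t 1 = 0 ∧
      Function.update (0 : Site 3) 2 t 2 = t := by
  refine ⟨?_, ?_, ?_⟩ <;> simp

/-- Coordinates of the points `(0,1,t)`. [folklore] -/
theorem e₂AxisPt_coords (t : ℤ) :
    Function.update (e₂ : Site 3) 2 t 0 = 0 ∧ Function.update (e₂ : Site 3) 2 t 1 = 1 ∧
      Function.update (e₂ : Site 3) 2 t 2 = t := by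
  refine ⟨?_, ?_, ?_⟩ <;> simp

/-- **Avoidance inside `Λ_R` from the two hole cylinders**: if the first trace has no open pair at any
site of the hole `Λ_R ∖ T₁` and the second none at any site of `Λ_R ∖ T₂`, then the clusters of `0` (first trace)
and of `e₂` (second trace) share no site of `Λ_R` (a site of the hole is isolated, hence in neither
cluster; the two corridors are disjoint). [folklore] -/
theorem prod_subset_compl_meetIn (R K : ℕ) :
    ({ω : BondConfig (Site 3) |
        ∀ x ∈ (box 3 R).filter (fun x : Site 3 => ¬(x 0 = 0 ∧ x 1 = 0 ∧ 0 ≤ x 2)), ∀ z : Site 3, s(x, z) ∉ ω} ×ˢ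
      {ω : BondConfig (Site 3) |
        ∀ x ∈ (box 3 R).filter (fun x : Site 3 => ¬(x 0 = 0 ∧ x 1 = 1 ∧ x 2 ≤ 0)), ∀ z : Site 3, s(x, z) ∉ ω}) ⊆
      (MeetIn R (pinch K))ᶜ := by
  rintro ⟨ω₁, ω₂⟩ ⟨h₁, h₂⟩ ⟨u, huR, hu₁, hu₂⟩
  change u ∈ openCluster ω₁ 0 at hu₁
  change u ∈ openCluster ω₂ e₂ at hu₂
  obtain ⟨he0, he1, he2⟩ := e₂_coords'
  have hu0 : ¬(u 0 = 0 ∧ u 1 = 0 ∧ 0 ≤ u 2) → False := fun hpred => by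
    have huS : u ∈ (box 3 R).filter (fun x : Site 3 => ¬(x 0 = 0 ∧ x 1 = 0 ∧ 0 ≤ x 2)) :=
      Finset.mem_filter.2 ⟨huR, hpred⟩
    have hne : u ≠ 0 := fun h => hpred (by subst h; simp)
    exact not_mem_openCluster_of_closed hne (h₁ u huS) hu₁
  have hu2 : ¬(u 0 = 0 ∧ u 1 = 1 ∧ u 2 ≤ 0) → False := fun hpred => by
    have huS : u ∈ (box 3 R).filter (fun x : Site 3 => ¬(x 0 = 0 ∧ x 1 = 1 ∧ x 2 ≤ 0)) :=
      Finset.mem_filter.2 ⟨huR, hpred⟩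
    have hne : u ≠ e₂ := fun h => hpred (by subst h; exact ⟨he0, he1, he2.le⟩)
    exact not_mem_openCluster_of_closed hne (h₂ u huS) hu₂
  have h0 := Classical.not_not.1 hu0
  have h2 := Classical.not_not.1 hu2
  omega

/-- **Near-pinch floor** (main form): for every `R` there is `δ₀ > 0` such that for all `K` with `2^K > R`,
eventually in `n`, `δ₀ ≤ avoidIn n R (pinch K)`. [cite: AizenmanDuminilCopinAnnals2021, §3.1] -/
theorem nearPinchFloor_main (R : ℕ) :
    ∃ δ₀ : ℝ, 0 < δ₀ ∧ ∀ K : ℕ, R < 2 ^ K → ∀ᶠ n : ℕ in atTop, δ₀ ≤ avoidIn n R (pinch K) := by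
  have hβ : 0 < criticalBeta 3 := criticalBeta_pos_holds (d := 3) (by norm_num)
  obtain ⟨he0, he1, he2⟩ := e₂_coords'
  -- the two holes `Λ_R ∖ T_i` and the two escape segments
  set holeOne : Finset (Site 3) := (box 3 R).filter (fun x : Site 3 => ¬(x 0 = 0 ∧ x 1 = 0 ∧ 0 ≤ x 2))
    with hholeOne
  set holeTwo : Finset (Site 3) := (box 3 R).filter (fun x : Site 3 => ¬(x 0 = 0 ∧ x 1 = 1 ∧ x 2 ≤ 0))
    with hholeTwo
  set segOne : Finset (Site 3) := (box 3 (R + 1)).filter (fun x : Site 3 => x 0 = 0 ∧ x 1 = 0 ∧ 0 ≤ x 2)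
    with hsegOne
  set segTwo : Finset (Site 3) := (box 3 (R + 1)).filter (fun x : Site 3 => x 0 = 0 ∧ x 1 = 1 ∧ x 2 ≤ 0)
    with hsegTwo
  -- positivity along the escape segments
  have hseg1 : ∀ t : ℕ, t ≤ R + 1 → Function.update (0 : Site 3) 2 (0 + (t : ℤ)) ∈ segOne := fun t ht => by
    obtain ⟨h0, h1, h2⟩ := zAxisPt_coords (0 + (t : ℤ))
    rw [hsegOne, Finset.mem_filter, mem_box_three, h0, h1, h2]; omega
  have hseg2 : ∀ t : ℕ, t ≤ R + 1 →
      Function.update (e₂ : Site 3) 2 (-((R : ℤ) + 1) + (t : ℤ)) ∈ segTwo := fun t ht => by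
    obtain ⟨h0, h1, h2⟩ := e₂AxisPt_coords (-((R : ℤ) + 1) + (t : ℤ))
    rw [hsegTwo, Finset.mem_filter, mem_box_three, h0, h1, h2]; omega
  have hpos1 := isingCorr_axisMove_pos (Λ' := segOne) hβ (0 : Site 3) 2 0 (R + 1) hseg1
  have hpos2 := isingCorr_axisMove_pos (Λ' := segTwo) hβ (e₂ : Site 3) 2 (-((R : ℤ) + 1)) (R + 1) hseg2
  set w₁ : Site 3 := Function.update (0 : Site 3) 2 (0 + ((R + 1 : ℕ) : ℤ)) with hw₁
  set w₂ : Site 3 := Function.update (e₂ : Site 3) 2 (-((R : ℤ) + 1)) with hw₂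
  have hstart1 : Function.update (0 : Site 3) 2 (0 : ℤ) = 0 := by simp
  have hend2 : Function.update (e₂ : Site 3) 2 (-((R : ℤ) + 1) + ((R + 1 : ℕ) : ℤ)) = e₂ := by
    rw [show -((R : ℤ) + 1) + ((R + 1 : ℕ) : ℤ) = (e₂ : Site 3) 2 by rw [he2]; push_cast; ring]
    exact Function.update_eq_self 2 (e₂ : Site 3)
  rw [hstart1] at hpos1
  rw [hend2, symmDiff_comm] at hpos2
  obtain ⟨hw₁0, hw₁1, hw₁2⟩ : w₁ 0 = 0 ∧ w₁ 1 = 0 ∧ w₁ 2 = 0 + ((R + 1 : ℕ) : ℤ) := zAxisPt_coords _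
  obtain ⟨hw₂0, hw₂1, hw₂2⟩ : w₂ 0 = 0 ∧ w₂ 1 = 1 ∧ w₂ 2 = -((R : ℤ) + 1) := e₂AxisPt_coords _
  -- hypotheses of the one-current floor
  have hS1 : holeOne ⊆ box 3 R := Finset.filter_subset _ _
  have hS2 : holeTwo ⊆ box 3 R := Finset.filter_subset _ _
  have hP1 : segOne ⊆ box 3 (R + 1) := Finset.filter_subset _ _
  have hP2 : segTwo ⊆ box 3 (R + 1) := Finset.filter_subset _ _
  have hPS1 : Disjoint (segOne) (holeOne) := Finset.disjoint_left.2 fun x hx hxS =>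
    (Finset.mem_filter.1 hxS).2 (Finset.mem_filter.1 hx).2
  have hPS2 : Disjoint (segTwo) (holeTwo) := Finset.disjoint_left.2 fun x hx hxS =>
    (Finset.mem_filter.1 hxS).2 (Finset.mem_filter.1 hx).2
  have h0P : (0 : Site 3) ∈ segOne := by
    have h := hseg1 0 (Nat.zero_le _); rwa [Nat.cast_zero, add_zero, hstart1] at h
  have hw₁P : w₁ ∈ segOne := hseg1 (R + 1) le_rfl
  have he₂P : (e₂ : Site 3) ∈ segTwo := by
    have h := hseg2 (R + 1) le_rfl; rwa [hend2] at h
  have hw₂P : w₂ ∈ segTwo := by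
    have h := hseg2 0 (Nat.zero_le _); rwa [Nat.cast_zero, add_zero] at h
  have hw₁shell : w₁ ∈ box 3 (R + 1) \ box 3 R := by
    rw [Finset.mem_sdiff, mem_box_three, mem_box_three, hw₁0, hw₁1, hw₁2]; push_cast; omega
  have hw₂shell : w₂ ∈ box 3 (R + 1) \ box 3 R := by
    rw [Finset.mem_sdiff, mem_box_three, mem_box_three, hw₂0, hw₂1, hw₂2]; omega
  obtain ⟨δ₁, hδ₁, hfloor1⟩ := traceLaw_hole_ge R hS1 hPS1 hP1 h0P hw₁shell hw₁P hpos1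
  obtain ⟨δ₂, hδ₂, hfloor2⟩ := traceLaw_hole_ge R hS2 hPS2 hP2 he₂P hw₂shell hw₂P hpos2
  refine ⟨δ₁ * δ₂, mul_pos hδ₁ hδ₂, fun K hK => ?_⟩
  obtain ⟨hp0, hp1, hp2⟩ := pFar_coords K
  obtain ⟨hq0, hq1, hq2⟩ := qFar_coords K
  have hKz : (R : ℤ) < (2 : ℤ) ^ K := by exact_mod_cast hK
  filter_upwards [eventually_ge_atTop (2 ^ K)] with n hn
  have hnz : (2 : ℤ) ^ K ≤ (n : ℤ) := by exact_mod_cast hn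
  have hRn : R + 1 ≤ n := by
    have : R < n := by exact_mod_cast (hKz.trans_le hnz)
    omega
  have h2pos : (0 : ℤ) < 2 ^ K := pow_pos (by norm_num) K
  have hpn : pFar K ∈ box 3 n \ box 3 R := by
    rw [Finset.mem_sdiff, mem_box_three, mem_box_three, hp0, hp1, hp2]; omega
  have hqn : qFar K ∈ box 3 n \ box 3 R := by
    rw [Finset.mem_sdiff, mem_box_three, mem_box_three, hq0, hq1, hq2]; omega
  have hp0' : pFar K ≠ 0 := fun h => by have := congr_fun h 0; rw [hp0] at this; simp at this
  have hqe : qFar K ≠ e₂ := fun h => by have := congr_fun h 0; rw [hq0, he0] at this; omega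
  have hE₁ := hfloor1 n hRn (pFar K) hpn hp0'
  have hE₂ := hfloor2 n hRn (qFar K) hqn hqe
  -- probability measures
  have hZ : ∀ {a v : Site 3}, a ∈ box 3 n → v ∈ box 3 n → v ≠ a →
      IsProbabilityMeasure (sourcedDoubleCurrentLaw 3 n (criticalBeta 3) ({a} ∆ {v}) ∅) := by
    intro a v ha hv hva
    refine isProbabilityMeasure_sourcedDoubleCurrentLaw hβ.le
      (currentSum_boxSources_pos 3 hβ (pair_symmDiff_subset ha hv) ?_).ne' ?_
    · rw [card_pair_symmDiff (Ne.symm hva)]; exact even_two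
    · rw [boxSources_empty]; exact (currentSum_empty_pos' _ _).ne'
  have he₂n : (e₂ : Site 3) ∈ box 3 n := by rw [mem_box_three, he0, he1, he2]; omega
  haveI := hZ (zero_mem_box 3 n) (Finset.mem_sdiff.1 hpn).1 hp0'
  haveI := hZ he₂n (Finset.mem_sdiff.1 hqn).1 hqe
  change δ₁ * δ₂ ≤ ((sourcedDoubleCurrentLaw 3 n βc ({(0 : Site 3)} ∆ {pFar K}) ∅).prod
    (sourcedDoubleCurrentLaw 3 n βc ({e₂} ∆ {qFar K}) ∅)).real (MeetIn R (pinch K))ᶜ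
  calc δ₁ * δ₂ ≤ (sourcedDoubleCurrentLaw 3 n βc ({(0 : Site 3)} ∆ {pFar K}) ∅).real
          {ω : BondConfig (Site 3) | ∀ x ∈ holeOne, ∀ z : Site 3, s(x, z) ∉ ω} *
        (sourcedDoubleCurrentLaw 3 n βc ({e₂} ∆ {qFar K}) ∅).real
          {ω : BondConfig (Site 3) | ∀ x ∈ holeTwo, ∀ z : Site 3, s(x, z) ∉ ω} :=
        mul_le_mul hE₁ hE₂ hδ₂.le (hδ₁.le.trans hE₁)
    _ = ((sourcedDoubleCurrentLaw 3 n βc ({(0 : Site 3)} ∆ {pFar K}) ∅).prod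
          (sourcedDoubleCurrentLaw 3 n βc ({e₂} ∆ {qFar K}) ∅)).real
          ({ω : BondConfig (Site 3) | ∀ x ∈ holeOne, ∀ z : Site 3, s(x, z) ∉ ω} ×ˢ
            {ω : BondConfig (Site 3) | ∀ x ∈ holeTwo, ∀ z : Site 3, s(x, z) ∉ ω}) :=
        (measureReal_prod_prod _ _).symm
    _ ≤ _ := measureReal_mono (prod_subset_compl_meetIn R K)

end NearPinchFloorProof

open Summit.CriticalPhenomena.Ising3DConformalLimit.GapForcesFarMergingSandwich

/-- **NEAR-PINCH FLOOR** (registered helper of `stub_octaveCounting`): for every radius `R` there is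
`δ₀ > 0` such that for every far octave `K` with `2^K > R`, eventually in the box size, the two independent
duplicated clusters of the one-pinch system avoid each other inside `Λ_R` with probability `≥ δ₀` — uniformly
in the far ends (finite-energy surgery: two disjoint escape corridors, one per current).
[cite: AizenmanDuminilCopinAnnals2021, §3.1] -/
theorem nearPinchFloor : ∀ R : ℕ, ∃ δ₀ : ℝ, 0 < δ₀ ∧ ∀ K : ℕ, R < 2 ^ K → ∀ᶠ n : ℕ in Filter.atTop, δ₀ ≤ avoidIn n R (pinch K) :=
  NearPinchFloorProof.nearPinchFloor_main

end Summit.CriticalPhenomena.Ising3DConformalLimit.EnergyNotSigmaSquaredGapForcesFarMergingSandwich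

end
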